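import Summits.CriticalPhenomena.PercolationContinuityZ3.Theorems.Transplant.HalfSpaceUniquenessGeometry
import Literature.Probability.Percolation.ExteriorConnectionEvents
import Literature.Probability.Percolation.HalfSpace
import HarnessLib

/-!
# The exterior step graph of a box in the half-space; classification of the inner boundary

builds on p205010 (kernel theorem, internal audit signed; external expert review pending) — nothing in this file uses p205010.
Lane `prim-bschramm`, seat `prim-bschramm-p2` gen 16 (class C1b); helper file (`--supports stmt-CriticalPhenomena-4575 --as helper`)
for the half-space uniqueness programme (TARGET 3g): the data of the Aizenman–Chayes–Chayes–Fröhlich–Russo criterion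
(`Literature/…/ExteriorConnectionUniqueness.lean`) for the half-space `ℍ = {x_0 ≥ 0} ⊂ ℤ^d`.

* `hsGraph d = withinGraph ℤ^d ℍ` — the steps of `ℤ^d` inside `ℍ`, a graph on ALL of `ℤ^d` (sites below the floor are isolated);
  `boxSet d N = [-N, N]^d`; `extGraph d N = starGraph (hsGraph d) univ (boxSet d N)` — the EXTERIOR steps of the box: steps of `ℍ`
  not having both endpoints in the box;
* `extGraph_adj_of`, `withinGraph_le_extGraph` — steps inside a region of `ℍ` meeting the box in at most one point are exterior steps;
* **`innerBdry_cases`**: a vertex of the box with an `ℍ`-neighbour outside the box lies in `ℍ` and on the TOP face `{x_0 = N}` or on a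
  SIDE face `{x_i = σ N}`, `i ≠ 0`, `σ = ±1` (the outward normal recorded as the neighbour's displacement);
* `boxSet_finite`, `boxSet_mono`, `boxSet_exhaust` — the exhaustion hypotheses of the criterion.
[cite: AizenmanChayesChayesFrohlichRusso1983, §4 (4.25)–(4.27)] [cite: BarskyGrimmettNewman1991, Comment 6 p. 116] -/

noncomputable section

namespace Summit.CriticalPhenomena.PercolationContinuityZ3.Theorems.Transplant

namespace HSU

open Literature.Probability.Percolation Literature.Probability.LatticeModels SimpleGraph

variable {d : ℕ}

/-! ## §1 The graphs -/

/-- The half-space step graph on `ℤ^d`: steps of `ℤ^d` with both endpoints in `ℍ = {x_0 ≥ 0}`. [cite: BarskyGrimmettNewman1991, §1 p. 113 (the subgraph with vertex set 𝕃)] -/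
abbrev hsGraph (d : ℕ) [NeZero d] : SimpleGraph (Site d) := withinGraph (zdGraph d) (halfSpace d)

/-- The box `[-N, N]^d` as a set. [folklore] -/
abbrev boxSet (d N : ℕ) : Set (Site d) := ↑(box d N)

/-- The exterior step graph of the box: steps of `ℍ` not having both endpoints in `[-N, N]^d`.
[cite: AizenmanChayesChayesFrohlichRusso1983, §4 Cor. to Lemma 4.3 (paths in 𝕃 ∖ Λ)] -/
abbrev extGraph (d : ℕ) [NeZero d] (N : ℕ) : SimpleGraph (Site d) := starGraph (hsGraph d) Set.univ (boxSet d N)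

/-- Membership in the box. [folklore] -/
theorem mem_boxSet_iff {N : ℕ} {x : Site d} : x ∈ boxSet d N ↔ ∀ j, -(N : ℤ) ≤ x j ∧ x j ≤ N := by
  rw [boxSet, Finset.mem_coe, mem_box]

/-- A site with a coordinate of absolute value `> N` is outside the box. [folklore] -/
theorem not_mem_boxSet_of_lt {N : ℕ} {x : Site d} {j : Fin d} (h : (N : ℤ) < |x j|) : x ∉ boxSet d N := by
  rw [mem_boxSet_iff]; intro hx; have := hx j
  rcases lt_abs.1 h with h | h <;> omega

/-- The boxes are finite. [folklore] -/
theorem boxSet_finite (N : ℕ) : (boxSet d N).Finite := Finset.finite_toSet _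

/-- The boxes increase. [folklore] -/
theorem boxSet_mono : Monotone (boxSet d) := by
  intro N N' h x hx
  rw [mem_boxSet_iff] at hx ⊢
  intro j; have := hx j; constructor <;> omega

/-- The boxes exhaust `ℤ^d`. [folklore] -/
theorem boxSet_exhaust (x : Site d) : ∃ N, x ∈ boxSet d N := by
  classical
  refine ⟨Finset.univ.sup fun j => (x j).natAbs, ?_⟩
  rw [mem_boxSet_iff]
  intro j
  have h : (x j).natAbs ≤ Finset.univ.sup fun j => (x j).natAbs := Finset.le_sup (f := fun j => (x j).natAbs) (Finset.mem_univ j)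
  constructor <;> omega

variable [NeZero d]

/-- Adjacency in the half-space step graph. [folklore] -/
theorem hsGraph_adj {x y : Site d} : (hsGraph d).Adj x y ↔ (zdGraph d).Adj x y ∧ 0 ≤ x 0 ∧ 0 ≤ y 0 := by
  rw [hsGraph, withinGraph_adj]; rfl

/-- **Exterior steps**: a lattice step between sites of `ℍ`, not both in the box, is an exterior step. [folklore] -/
theorem extGraph_adj_of {N : ℕ} {x y : Site d} (hxy : (zdGraph d).Adj x y) (hx : 0 ≤ x 0) (hy : 0 ≤ y 0)
    (hbox : ¬ (x ∈ boxSet d N ∧ y ∈ boxSet d N)) : (extGraph d N).Adj x y :=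
  ⟨hsGraph_adj.2 ⟨hxy, hx, hy⟩, Set.mem_univ _, Set.mem_univ _, hbox⟩

/-- **Steps inside a region of `ℍ` meeting the box in at most one point are exterior steps.** [folklore] -/
theorem withinGraph_le_extGraph {N : ℕ} {S : Set (Site d)} (hS : ∀ x ∈ S, 0 ≤ x 0)
    (h1 : ∀ x ∈ S, ∀ y ∈ S, x ∈ boxSet d N → y ∈ boxSet d N → x = y) :
    withinGraph (zdGraph d) S ≤ extGraph d N := by
  intro x y h
  rw [withinGraph_adj] at h
  exact extGraph_adj_of h.1 (hS x h.2.1) (hS y h.2.2) fun hb => h.1.ne (h1 x h.2.1 y h.2.2 hb.1 hb.2)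

/-- The exterior step graph is a subgraph of the half-space step graph. [folklore] -/
theorem extGraph_le (N : ℕ) : extGraph d N ≤ hsGraph d := starGraph_le _ _ _

/-! ## §2 The inner boundary of the box: top face or side face -/

/-- **Classification of the inner boundary.** If `u ∈ [-N,N]^d` has an `ℍ`-neighbour outside the box then `u ∈ ℍ` and either `u`
lies on the top face (`u_0 = N`) or on a side face: `u_i = σ N` for some `i ≠ 0`, `σ = ±1`, with `u + σ e_i` outside the box.
[cite: AizenmanChayesChayesFrohlichRusso1983, §4 (4.26) (∂Λ_{N,M})] -/
theorem innerBdry_cases {N : ℕ} {u : Site d} (hu : u ∈ boxSet d N) (hw : ∃ w, w ∉ boxSet d N ∧ (hsGraph d).Adj u w) :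
    0 ≤ u 0 ∧ (u 0 = N ∨ ∃ i : Fin d, i ≠ 0 ∧ ∃ σ : ℤ, (σ = 1 ∨ σ = -1) ∧ u i = σ * N) := by
  obtain ⟨w, hwbox, hadj⟩ := hw
  obtain ⟨hzd, hu0, hw0⟩ := hsGraph_adj.1 hadj
  refine ⟨hu0, ?_⟩
  rw [mem_boxSet_iff] at hu
  rw [mem_boxSet_iff] at hwbox
  push Not at hwbox
  obtain ⟨m, hm⟩ := hwbox
  obtain ⟨j, hj | hj⟩ := (zdGraph_adj_iff u w).1 hzd
  · -- `w = u + e_j`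
    have hwm : w m = u m + (Pi.single j (1 : ℤ) : Site d) m := by rw [hj]; rfl
    by_cases hmj : m = j
    · subst hmj
      rw [Pi.single_eq_same] at hwm
      have hum := hu m
      by_cases hm0 : m = 0
      · subst hm0; left; omega
      · right; exact ⟨m, hm0, 1, Or.inl rfl, by omega⟩
    · rw [Pi.single_eq_of_ne hmj, add_zero] at hwm
      have := hu m; omega
  · -- `u = w + e_j`
    have hum' : u m = w m + (Pi.single j (1 : ℤ) : Site d) m := by rw [hj]; rfl
    by_cases hmj : m = j
    · subst hmj
      rw [Pi.single_eq_same] at hum'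
      have hum := hu m
      by_cases hm0 : m = 0
      · subst hm0; omega
      · right; exact ⟨m, hm0, -1, Or.inr rfl, by omega⟩
    · rw [Pi.single_eq_of_ne hmj, add_zero] at hum'
      have := hu m; omega

/-! ## §3 Segments and small boxes used for the junctions -/

omit [NeZero d] in
/-- Points of the bounding box of `{x, y}` have every coordinate between those of `x` and `y`; in particular a coordinate on which
`x` and `y` agree is constant on the box. [folklore] -/
theorem eq_of_mem_bbox {x y z : Site d} (hz : ∀ j, min (x j) (y j) ≤ z j ∧ z j ≤ max (x j) (y j)) {j : Fin d} (h : x j = y j) :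
    z j = x j := by
  have := hz j; rw [h, min_self, max_self] at this; omega

/-- **The outward segment is exterior.** For `u` on the side face `u_i = σN` (`u_0 ≥ 0`) and `u' = u` off coordinate `i` with
`σ u'_i ≥ N`, the steps inside the bounding box of `{u, u'}` are exterior steps (the box meets `[-N,N]^d` only in `u`). [folklore] -/
theorem bbox_segment_le_extGraph {N : ℕ} {u u' : Site d} {i : Fin d} {σ : ℤ} (hσ : σ = 1 ∨ σ = -1) (hu0 : 0 ≤ u 0)
    (hui : u i = σ * N) (hu'i : (N : ℤ) ≤ σ * u' i) (hrest : ∀ j, j ≠ i → u' j = u j) (hi : i ≠ 0) :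
    withinGraph (zdGraph d) {z | ∀ j, min (u j) (u' j) ≤ z j ∧ z j ≤ max (u j) (u' j)} ≤ extGraph d N := by
  have hcoord : ∀ z : Site d, (∀ j, min (u j) (u' j) ≤ z j ∧ z j ≤ max (u j) (u' j)) → ∀ j, j ≠ i → z j = u j :=
    fun z hz j hj => eq_of_mem_bbox hz (hrest j hj).symm
  have hσzi : ∀ z : Site d, (∀ j, min (u j) (u' j) ≤ z j ∧ z j ≤ max (u j) (u' j)) → (N : ℤ) ≤ σ * z i := by
    intro z hz
    have := hz i
    rcases hσ with rfl | rfl <;> [skip; skip] <;> omega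
  refine withinGraph_le_extGraph (fun z hz => by rw [hcoord z hz 0 (Ne.symm hi)]; exact hu0) fun x hx y hy hxb hyb => ?_
  -- both in the box: then `σ x_i ≤ N`, so `x_i = σ N = u_i`, and likewise for `y`; all other coordinates agree with `u`
  rw [mem_boxSet_iff] at hxb hyb
  have hx' := hσzi x hx
  have hy' := hσzi y hy
  funext j
  by_cases hj : j = i
  · subst hj
    have h1 := hxb j; have h2 := hyb j
    rcases hσ with rfl | rfl <;> omega
  · rw [hcoord x hx j hj, hcoord y hy j hj]

/-- **A region of `ℍ` off the box is exterior**: if every point of `S` has `x_0 ≥ 0` and a coordinate of absolute value `> N`, the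
steps inside `S` are exterior steps. [folklore] -/
theorem withinGraph_le_extGraph_of_forall_not_mem {N : ℕ} {S : Set (Site d)} (hS : ∀ x ∈ S, 0 ≤ x 0 ∧ x ∉ boxSet d N) :
    withinGraph (zdGraph d) S ≤ extGraph d N :=
  withinGraph_le_extGraph (fun x hx => (hS x hx).1) fun x hx _ _ hxb _ => ((hS x hx).2 hxb).elim

end HSU

end Summit.CriticalPhenomena.PercolationContinuityZ3.Theorems.Transplant

end
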